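import Mathlib
import Summits.KontsevichZagierPeriods.KontsevichZagierPeriods.Theorems.SoloInformedHoffmanPieces
import Summits.KontsevichZagierPeriods.KontsevichZagierPeriods.Theorems.SoloInformedHookSeries
import Literature.NumberTheory.Transcendental.MultipleZetaHoffmanDualProofs
import HarnessLib
import HarnessLib.Audit

/-!
# THEOREM L — Hoffman's relation at every depth, in the formal period ring `𝒫`

For every admissible index `u = (u₀, …, u_k)` (descending convention, `u₀ ≥ 2`) the relation of
[Hoffman 1992, Thm 5.1] [cite: Hoffman1992, Thm 5.1]

  `Σ_{i=0}^{k} Z(u₀,…,uᵢ+1,…,u_k) = Σ_{i=0}^{k} Σ_{a=1}^{uᵢ−1} Z(u₀,…,u_{i−1}, a+1, uᵢ−a, u_{i+1},…,u_k)`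

holds between the classes `Z(·) = mzvClass ·` in `𝒫 = ℤ[KZ-reps]/KZ.relations`, i.e. it is generated
by the three Kontsevich–Zagier rules.  This is the first all-depth family of *regularised* double-shuffle
relations (it is `reg_ш(1) ш u − reg_*(1) * u`, the linear part of Racinet's/IKZ's comparison) obtained
in `𝒫`; depth-wise it is new already for depth `≥ 3`.

Proof.  The SCALE BAND STEP (THEOREM XLIX, `SoloInformedScaleDatum.scale`, rule (3) = Newton–Leibniz
in the band variable) applied to the Hoffman datum gives `⟦A⟧ = ⟦B⟧` with
`A = [ω < x₀ on the open cube, G_u/(1−ω)]` and `B = [cube, stuffle-type integrand]`;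
`⟦B⟧ = Σ_i Z(ins_{i+1}) + Σ_i Z(merge_i)` (`soloInformed_hofB_class`, harmonic labellings) and
`⟦A⟧ = Σ_{s ≠ 0} Z(word of u with the letter 1 inserted at slot s)` (`soloInformed_hof_repA_class`,
garland dissection + Nash blow-down).  This file identifies the inserted words with indices
(`soloInformed_hofIdx_block`, `soloInformed_hofIdx_boundary`), regroups the slot sum by blocks
(`soloInformed_sum_slots_by_blocks`) and cancels the boundary slots against the insertion terms.
-/

open scoped BigOperators
open MeasureTheory Set MvPolynomial FreeAbelianGroup
open Literature.NumberTheory.Transcendental Literature.NumberTheory.Transcendental.KZ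

namespace Summit.KontsevichZagierPeriods.KontsevichZagierPeriods.Theorems

/-! ## 1. The word form -/

section

variable {u : List ℕ} {m k : ℕ} (hu : MZV.IsAdmissible u) (hw : MZV.weight u = m + 1)
  (hk : u.length = k + 1)
include hu hw hk

/-- **THEOREM L (word form).**  In `𝒫`: the sum over the `m + 1` nonzero slots `s` of the class of the
word of `u` with the letter `1` inserted at `s` equals the sum of the insertion terms
`Z(u₀..uᵢ, 1, uᵢ₊₁..)` (`i = 0..k`) plus the merge terms `Z(u₀.., uᵢ + 1, ..)` (`i = 0..k`). -/
theorem soloInformed_hoffman_word :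
    ∑ s ∈ Finset.univ.erase (0 : Fin (m + 2)), mzvClass (soloInformedHofIdx u s) =
      ∑ i : Fin (k + 1), mzvClass (u.take (i + 1) ++ 1 :: u.drop (i + 1)) +
        ∑ i : Fin (k + 1), mzvClass (u.take i ++ (1 + u[(i : ℕ)]'(by omega)) :: u.drop (i + 1)) := by
  rw [← soloInformed_hof_repA_class hu hw hk, ← soloInformed_hofB_class hu hw hk]
  exact toFormalPeriod_eq_iff.2 (soloInformedHofDatum hu hw hk).scale

end

/-! ## 2. THEOREM L -/

/-- The slot sum over `Fin (m+2) ∖ {0}` as a sum over `1 … m+1`. -/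
theorem soloInformed_sum_erase_zero_eq_Ico {M : Type*} [AddCommGroup M] (F : ℕ → M) (m : ℕ) :
    ∑ s ∈ Finset.univ.erase (0 : Fin (m + 2)), F s = ∑ s ∈ Finset.Ico 1 (m + 2), F s := by
  rw [Finset.sum_erase_eq_sub (Finset.mem_univ _), Fin.sum_univ_eq_sum_range (fun s => F s),
    Finset.range_eq_Ico, Finset.sum_eq_sum_Ico_succ_bot (by omega : 0 < m + 2), Fin.val_zero,
    add_sub_cancel_left]

/-- **THEOREM L (Hoffman's relation [Hoffman 1992, Thm 5.1], at every depth, in `𝒫`).**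
For every admissible index `u = (u₀, …, u_k)`:
`Σ_{i=0}^{k} Z(u₀,…,uᵢ+1,…,u_k) = Σ_{i=0}^{k} Σ_{a=1}^{uᵢ−1} Z(u₀,…,u_{i−1}, a+1, uᵢ−a, u_{i+1},…,u_k)`
holds between the classes in the formal period ring, i.e. it is generated by the Kontsevich–Zagier
rules (additivity, algebraic change of variables, Newton–Leibniz). [cite: Hoffman1992, Thm 5.1] -/
theorem soloInformed_mzvClass_hoffman {u : List ℕ} {k : ℕ} (hu : MZV.IsAdmissible u)
    (hk : u.length = k + 1) :
    ∑ i : Fin (k + 1), mzvClass (u.take i ++ (u[(i : ℕ)]'(by omega) + 1) :: u.drop (i + 1)) =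
      ∑ i : Fin (k + 1), ∑ a ∈ Finset.Ico 1 (u[(i : ℕ)]'(by omega)),
        mzvClass (u.take i ++ (a + 1) :: (u[(i : ℕ)]'(by omega) - a) :: u.drop (i + 1)) := by
  have hpos := hu.1
  have hne : u ≠ [] := List.ne_nil_of_length_eq_add_one hk
  have h2 : 2 ≤ u.sum := by
    obtain ⟨a, u', rfl⟩ := List.exists_cons_of_ne_nil hne
    have := hu.2 (List.cons_ne_nil a u')
    simp only [List.head_cons, List.sum_cons] at this ⊢
    omega
  obtain ⟨m, hm⟩ : ∃ m, u.sum = m + 1 := ⟨u.sum - 1, by omega⟩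
  have hw : MZV.weight u = m + 1 := hm
  have H := soloInformed_hoffman_word hu hw hk
  rw [soloInformed_sum_erase_zero_eq_Ico (fun s => mzvClass (soloInformedHofIdx u s)),
    show m + 2 = (u.take (k + 1)).sum + 1 by rw [soloInformed_take_sum_last hk]; omega,
    soloInformed_sum_slots_by_blocks hpos hk _ le_rfl, Finset.sum_add_distrib] at H
  -- the boundary slots are the insertion terms
  have hbdy : ∑ i ∈ Finset.range (k + 1), mzvClass (soloInformedHofIdx u (u.take (i + 1)).sum) =
      ∑ i : Fin (k + 1), mzvClass (u.take (i + 1) ++ 1 :: u.drop (i + 1)) := by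
    rw [Fin.sum_univ_eq_sum_range (fun i => mzvClass (u.take (i + 1) ++ 1 :: u.drop (i + 1)))]
    exact Finset.sum_congr rfl fun i _ => by rw [soloInformed_hofIdx_boundary hpos]
  -- the interior slots are the right-hand side
  have hint : ∑ i ∈ Finset.range (k + 1), ∑ a ∈ Finset.Ico 1 (u.getD i 0),
      mzvClass (soloInformedHofIdx u ((u.take i).sum + a)) =
      ∑ i : Fin (k + 1), ∑ a ∈ Finset.Ico 1 (u[(i : ℕ)]'(by omega)),
        mzvClass (u.take i ++ (a + 1) :: (u[(i : ℕ)]'(by omega) - a) :: u.drop (i + 1)) := by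
    set G : ℕ → FormalPeriodRing := fun i => ∑ a ∈ Finset.Ico 1 (u.getD i 0),
      mzvClass (u.take i ++ (a + 1) :: (u.getD i 0 - a) :: u.drop (i + 1)) with hG_def
    have hG : ∀ i : Fin (k + 1), ∑ a ∈ Finset.Ico 1 (u[(i : ℕ)]'(by omega)),
        mzvClass (u.take i ++ (a + 1) :: (u[(i : ℕ)]'(by omega) - a) :: u.drop (i + 1)) = G i := by
      intro i
      rw [hG_def]
      simp only [List.getD_eq_getElem _ _ (show (i : ℕ) < u.length by omega)]
    rw [Finset.sum_congr rfl fun i _ => hG i, Fin.sum_univ_eq_sum_range G (k + 1)]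
    refine Finset.sum_congr rfl fun i hi => ?_
    have hi' : i ≤ k := by simpa [Finset.mem_range, Nat.lt_succ_iff] using hi
    have hget : u.getD i 0 = u[i]'(by omega) := List.getD_eq_getElem _ _ (by omega)
    rw [hG_def]
    simp only [hget]
    refine Finset.sum_congr rfl fun a ha => ?_
    rw [Finset.mem_Ico] at ha
    rw [soloInformed_hofIdx_block hpos hk hi' (by omega)]
  -- the merge terms are the left-hand side
  have hmerge : ∑ i : Fin (k + 1), mzvClass (u.take i ++ (1 + u[(i : ℕ)]'(by omega)) :: u.drop (i + 1)) =
      ∑ i : Fin (k + 1), mzvClass (u.take i ++ (u[(i : ℕ)]'(by omega) + 1) :: u.drop (i + 1)) :=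
    Finset.sum_congr rfl fun i _ => by rw [Nat.add_comm 1]
  rw [hbdy, hint, hmerge, add_comm] at H
  exact (add_left_cancel H).symm

/-! ## 3. A computable form (for instances: both sides as explicit lists of indices) -/

/-- The left side of Hoffman's relation as a list of indices: `(u₀,…,uᵢ+1,…,u_k)`, `i = 0..k`. -/
def soloInformedHofLHS (u : List ℕ) : List (List ℕ) :=
  (List.range u.length).map fun i => u.take i ++ (u.getD i 0 + 1) :: u.drop (i + 1)

/-- The right side of Hoffman's relation as a list of indices:
`(u₀,…,u_{i−1}, a'+2, uᵢ−1−a', u_{i+1},…)`, `i = 0..k`, `a' = 0..uᵢ−2`. -/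
def soloInformedHofRHS (u : List ℕ) : List (List ℕ) :=
  (List.range u.length).flatMap fun i =>
    (List.range (u.getD i 0 - 1)).map fun a => u.take i ++ (a + 2) :: (u.getD i 0 - 1 - a) :: u.drop (i + 1)

/-- **THEOREM L, computable form.**  For admissible nonempty `u`:
`Σ (soloInformedHofLHS u) = Σ (soloInformedHofRHS u)` on classes in `𝒫`; both lists evaluate by `rfl`/`decide`
on numerals, so every instance of Hoffman's relation is one rewrite away. [cite: Hoffman1992, Thm 5.1] -/
theorem soloInformed_mzvClass_hoffman_list {u : List ℕ} (hu : MZV.IsAdmissible u) (hne : u ≠ []) :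
    ((soloInformedHofLHS u).map mzvClass).sum = ((soloInformedHofRHS u).map mzvClass).sum := by
  obtain ⟨k, hk⟩ : ∃ k, u.length = k + 1 := ⟨u.length - 1, by
    have := List.length_pos_of_ne_nil hne; omega⟩
  have H := soloInformed_mzvClass_hoffman hu hk
  have hget : ∀ i : Fin (k + 1), u[(i : ℕ)]'(by omega) = u.getD i 0 := fun i =>
    (List.getD_eq_getElem _ _ (by omega)).symm
  simp only [hget] at H
  rw [Fin.sum_univ_eq_sum_range (fun i => mzvClass (u.take i ++ (u.getD i 0 + 1) :: u.drop (i + 1))) (k + 1),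
    Fin.sum_univ_eq_sum_range (fun i => ∑ a ∈ Finset.Ico 1 (u.getD i 0),
      mzvClass (u.take i ++ (a + 1) :: (u.getD i 0 - a) :: u.drop (i + 1))) (k + 1)] at H
  rw [soloInformedHofLHS, soloInformedHofRHS, hk, List.map_map, soloInformed_sum_map_flatMap,
    ← soloInformed_sum_range_eq_list, ← soloInformed_sum_range_eq_list]
  convert H using 2 with i _ i _
  · rfl
  · rw [List.map_map, ← soloInformed_sum_range_eq_list, Finset.sum_Ico_eq_sum_range]
    refine Finset.sum_congr rfl fun a _ => ?_
    rw [Function.comp_apply, show 1 + a + 1 = a + 2 by ring,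
      show u.getD i 0 - (1 + a) = u.getD i 0 - 1 - a by omega]

end Summit.KontsevichZagierPeriods.KontsevichZagierPeriods.Theorems
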